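import Summits.Ventures.PercRepro.Night2BasisFaceSum
import Summits.Ventures.PercRepro.Night2BasisLoadedB

/-!
# night-2: the FAT case of the basis pairs' fair share — the targets containing the off-point

In the cell `(2, 1)` with a fat closure `clF B₀` (`|G ∖ clF B₀| = 2`), every lossy basis pair `(B, z)` has
EXACTLY ONE of the two points off `clF B₀` in `Q = insert z B` (`exists_fat_split`: `G ∖ clF B₀ = {w₀, x}`,
`w₀ ∈ Q`, `x ∉ Q`): if both were in `Q`, at most two faces of `Q` could be thin members (the complement of any
other face lies in `clF B₀ ∖ K`, of rank `4`, while a bottom set leaves rank `≥ 5` in `G`: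
`five_le_rkN_sdiff_of_mem_Uq`), so `L1 Q ≤ 7/12 < 11/18 ≤ capS Q` and the pair would lose nothing.

At every target `T ⊇ Q` containing the off-point `x`, NO face is a thin member (`not_faceOk_of_fat_off_mem`:
the faces at `x` and at `w₀` have rank `6`, every other face leaves `G ∖ (T.erase w) ⊆ clF B₀ ∖ K`), so
`L1 T = 0` (`L1_eq_zero_of_fat_off_mem`) and the typed floor is `≥ 11/18` at every unloaded such target
(`eleven_eighteenths_le_vType_of_fat_off_mem`).  The sub-family form of the face criterion
(`basis_pair_fair_of_face_sum_subfamily`) then reduces the fat case of (FAIR) to the single inequality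
`1 ≤ Σ_{T ∋ x, dload T = 0} (11/18) / faceSum T` (`basis_pair_fair_of_fat_off_sum`) — paper
`proofs/NIGHT-2-g32.md` §1–§2 (numerics: that sum is `≥ 1.48` on every instance run, `≥ 2.0` for `|G| ≥ 12`).
-/

namespace PercRepro.Shadow

open PercRepro.ThmH PercRepro.PerFlat

variable {α : Type*} [DecidableEq α] {M : Matroid α} [M.Finite] {G : Finset α}

/-- The complement in `G` of a bottom set of the cell has rank at least `5`: `rk (gr ∖ B) = 7 ≤ rk (G ∖ B) + 2`. -/
theorem five_le_rkN_sdiff_of_mem_Uq (hd : (gr M \ G).card = 2) {B : Finset α} (hB : B ∈ Uq M (5 + 2) 5) :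
    5 ≤ rkN M (G \ B) := by
  have h7 := rkN_sdiff_eq_of_mem_Uq hB
  have hsub : gr M \ B ⊆ (G \ B) ∪ (gr M \ G) := by
    intro e he
    rw [Finset.mem_sdiff] at he
    rw [Finset.mem_union, Finset.mem_sdiff, Finset.mem_sdiff]
    by_cases heG : e ∈ G
    · exact Or.inl ⟨heG, he.2⟩
    · exact Or.inr ⟨he.1, heG⟩
  have h1 := rkN_mono (M := M) hsub
  have h2 := rkN_union_le_add_card (M := M) (G \ B) (gr M \ G)
  rw [hd] at h2
  omega

/-- A set whose complement in `G` has rank at most `4` is not a thin member. -/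
theorem notMem_thinMembers_of_rkN_sdiff_le_four (hd : (gr M \ G).card = 2) {B : Finset α}
    (hr : rkN M (G \ B) ≤ 4) : B ∉ thinMembers M 5 G := by
  intro hB
  have h := five_le_rkN_sdiff_of_mem_Uq hd (mem_membersIn.1 (mem_thinMembers.1 hB).1).1
  omega

/-- **The fat split of a lossy basis pair**: with a fat closure `clF B₀` (`|G ∖ clF B₀| = 2`), exactly one of the
two points off it lies in `Q = insert z B`: `G ∖ clF B₀ = {w₀, x}` with `w₀ ∈ Q` and `x ∉ Q`. -/
theorem exists_fat_split (hG : G ∈ flatsQ M (5 + 1)) (hd : (gr M \ G).card = 2) (hk : kColoops M G = 1)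
    {B₀ : Finset α} (hB₀ : B₀ ∈ thinMembers M 5 G) (hm₀ : (G \ clF M B₀).card = 2)
    {B : Finset α} (hB : B ∈ thinMembers M 5 G) {z : α} (hz : z ∈ G \ clF M B) (hl0 : loss M 5 G B z ≠ 0) :
    ∃ w₀ x, G \ clF M B₀ = {w₀, x} ∧ w₀ ≠ x ∧ w₀ ∈ insert z B ∧ x ∉ insert z B := by
  have hd' : (gr M \ G).card ≤ 5 := by omega
  obtain ⟨a, b, hab, hD⟩ := Finset.card_eq_two.1 hm₀
  have hQ6 := rkN_insert_eq_six_of_thin hG hB hz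
  have hQG : insert z B ⊆ G :=
    Finset.insert_subset (Finset.mem_sdiff.1 hz).1 (subset_G_of_mem_thinMembers hB)
  have hKQ : coloops M G ⊆ insert z B :=
    (coloops_subset_of_mem_thinMembers hG hd' hB).trans (Finset.subset_insert _ _)
  -- a point of `G` off `clF B₀` is `a` or `b`
  have hmemD : ∀ e ∈ G, e ∉ clF M B₀ → e = a ∨ e = b := by
    intro e he hcl
    have : e ∈ ({a, b} : Finset α) := by
      rw [← hD, Finset.mem_sdiff]
      exact ⟨he, hcl⟩
    simpa using this
  -- `Q` has rank `6`, so it is not inside `clF B₀`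
  have hnot : ¬ insert z B ⊆ clF M B₀ := by
    intro hsub
    have := rkN_le_of_subset_clF' (M := M) hsub
    rw [rkN_eq_five_of_mem_thinMembers hB₀] at this
    omega
  -- not both in `Q`: otherwise every good face of `Q` is `Q.erase a` or `Q.erase b`, `L1 ≤ 7/12`, no loss
  have hnotboth : ¬ (a ∈ insert z B ∧ b ∈ insert z B) := by
    rintro ⟨ha, hb⟩
    apply hl0
    apply loss_eq_zero_of_unsat
    have hcap := capS_ge_eleven_eighteenths_two_one hd hk hQG
    have hL1 : L1 M 5 G (insert z B) ≤ 7 / 12 := by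
      rw [L1_eq_sum_req_faces hG hd]
      have hfilt : (insert z B \ coloops M G).filter (fun w => faceOk M G (insert z B) w) ⊆ {a, b} := by
        intro w hw
        rw [Finset.mem_filter, Finset.mem_sdiff] at hw
        obtain ⟨⟨hwQ, hwK⟩, hok⟩ := hw
        by_contra hwab
        have hwcl : w ∈ clF M B₀ := by
          by_contra h
          rcases hmemD w (hQG hwQ) h with rfl | rfl
          · exact hwab (Finset.mem_insert_self _ _)
          · exact hwab (Finset.mem_insert_of_mem (Finset.mem_singleton_self _))
        apply notMem_thinMembers_of_rkN_sdiff_le_four hd _ hok.1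
        have hsub : G \ (insert z B).erase w ⊆ clF M B₀ \ coloops M G := by
          intro e he
          rw [Finset.mem_sdiff, Finset.mem_erase] at he
          rw [Finset.mem_sdiff]
          by_cases hew : e = w
          · subst hew
            exact ⟨hwcl, hwK⟩
          · have heQ : e ∉ insert z B := fun h => he.2 ⟨hew, h⟩
            refine ⟨?_, fun hK => heQ (hKQ hK)⟩
            by_contra hecl
            rcases hmemD e he.1 hecl with rfl | rfl
            · exact heQ ha
            · exact heQ hb
        calc rkN M (G \ (insert z B).erase w) ≤ rkN M (clF M B₀ \ coloops M G) := rkN_mono hsub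
          _ = 4 := rkN_clF_sdiff_coloops_eq_four_two hG hd hk hB₀
      have hcard := Finset.card_le_card hfilt
      rw [Finset.card_pair hab] at hcard
      have hcardQ : (((insert z B \ coloops M G).filter
          (fun w => faceOk M G (insert z B) w)).card : ℚ) ≤ 2 := by exact_mod_cast hcard
      calc ∑ w ∈ (insert z B \ coloops M G).filter (fun w => faceOk M G (insert z B) w),
            req M 5 ((insert z B).erase w)
          ≤ ∑ _w ∈ (insert z B \ coloops M G).filter (fun w => faceOk M G (insert z B) w), (7 / 24 : ℚ) := by
            apply Finset.sum_le_sum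
            intro w hw
            exact req_le_seven_div_24_of_thin hG hd (Finset.mem_filter.1 hw).2.1
        _ = (((insert z B \ coloops M G).filter (fun w => faceOk M G (insert z B) w)).card : ℚ) * (7 / 24) := by
            rw [Finset.sum_const, nsmul_eq_mul]
        _ ≤ 2 * (7 / 24 : ℚ) := by nlinarith
        _ = 7 / 12 := by norm_num
    linarith
  by_cases ha : a ∈ insert z B
  · exact ⟨a, b, hD, hab, ha, fun hb => hnotboth ⟨ha, hb⟩⟩
  · have hb : b ∈ insert z B := by
      by_contra hb
      apply hnot
      intro e he
      by_contra hcl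
      rcases hmemD e (hQG he) hcl with rfl | rfl
      · exact ha he
      · exact hb he
    refine ⟨b, a, ?_, hab.symm, hb, ha⟩
    rw [hD, Finset.pair_comm]

/-- **No face of a target containing the off-point is a thin member**: with the fat split `G ∖ clF B₀ = {w₀, x}`
(`w₀ ∈ Q`, `x ∉ Q`), at every `T ∈ tgtSets B z` with `x ∈ T` the predicate `faceOk T w` fails for every
`w ∈ T ∖ K` (the faces at `x` and at `w₀` have rank `6`; every other face leaves `G ∖ (T.erase w) ⊆ clF B₀ ∖ K`). -/
theorem not_faceOk_of_fat_off_mem (hG : G ∈ flatsQ M (5 + 1)) (hd : (gr M \ G).card = 2)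
    (hk : kColoops M G = 1) {B₀ : Finset α} (hB₀ : B₀ ∈ thinMembers M 5 G) {w₀ x : α}
    (hD : G \ clF M B₀ = {w₀, x}) {B : Finset α} (hB : B ∈ thinMembers M 5 G) {z : α}
    (hz : z ∈ G \ clF M B) (hw₀ : w₀ ∈ insert z B) (hx : x ∉ insert z B) {T : Finset α}
    (hT : T ∈ tgtSets M 5 G B z) (hxT : x ∈ T) {w : α} (hw : w ∈ T \ coloops M G) :
    ¬ faceOk M G T w := by
  intro hok
  obtain ⟨hthin, -⟩ := hok
  have hd' : (gr M \ G).card ≤ 5 := by omega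
  have hTG : T ⊆ G := subset_G_of_mem_shadowAt (mem_tgtSets.1 hT).1
  have hQT : insert z B ⊆ T := (mem_tgtSets.1 hT).2.1
  have hQ6 := rkN_insert_eq_six_of_thin hG hB hz
  have hGg : G ⊆ gr M := (mem_flatsQ.1 hG).1
  have hQG : insert z B ⊆ G :=
    Finset.insert_subset (Finset.mem_sdiff.1 hz).1 (subset_G_of_mem_thinMembers hB)
  have hKQ : coloops M G ⊆ insert z B :=
    (coloops_subset_of_mem_thinMembers hG hd' hB).trans (Finset.subset_insert _ _)
  have h5 := rkN_eq_five_of_mem_thinMembers hthin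
  rw [Finset.mem_sdiff] at hw
  have hoff : ∀ e ∈ G, e ∉ clF M B₀ → e = w₀ ∨ e = x := by
    intro e he hcl
    have : e ∈ ({w₀, x} : Finset α) := by
      rw [← hD, Finset.mem_sdiff]
      exact ⟨he, hcl⟩
    simpa using this
  have hxcl : x ∉ clF M B₀ := by
    have : x ∈ G \ clF M B₀ := by
      rw [hD]
      exact Finset.mem_insert_of_mem (Finset.mem_singleton_self _)
    exact (Finset.mem_sdiff.1 this).2
  by_cases hwx : w = x
  · -- the face at `x` contains `Q`, of rank `6`
    subst hwx
    have hsub : insert z B ⊆ T.erase w := by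
      intro e he
      rw [Finset.mem_erase]
      exact ⟨fun h => hx (h ▸ he), hQT he⟩
    have := rkN_mono (M := M) hsub
    omega
  by_cases hww₀ : w = w₀
  · -- the face at `w₀` contains `Q.erase w₀` (inside `clF B₀`, rank `≥ 5`) and `x ∉ clF B₀`: rank `≥ 6`
    subst hww₀
    have hQe : (insert z B).erase w ⊆ clF M B₀ := by
      intro e he
      rw [Finset.mem_erase] at he
      by_contra hcl
      rcases hoff e (hQG he.2) hcl with rfl | rfl
      · exact he.1 rfl
      · exact hx he.2
    have hxcl' : x ∉ clF M ((insert z B).erase w) := fun hxc =>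
      hxcl (clF_subset_clF_of_subset_clF hQe hxc)
    have hins := rkN_insert_eq_add_one_of_notMem_clF (M := M) ((Finset.erase_subset _ _).trans (hQG.trans hGg))
      (hGg (hTG hxT)) hxcl'
    have hge := rkN_erase_ge (M := M) (insert z B) w
    have hsub : insert x ((insert z B).erase w) ⊆ T.erase w := by
      intro e he
      rw [Finset.mem_insert] at he
      rw [Finset.mem_erase]
      rcases he with rfl | he
      · exact ⟨fun h => hx (h ▸ hw₀), hxT⟩
      · rw [Finset.mem_erase] at he
        exact ⟨he.1, hQT he.2⟩
    have := rkN_mono (M := M) hsub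
    omega
  -- every other face: `G ∖ (T.erase w) ⊆ clF B₀ ∖ K`, of rank `4`
  have hwcl : w ∈ clF M B₀ := by
    by_contra h
    rcases hoff w (hTG hw.1) h with rfl | rfl
    · exact hww₀ rfl
    · exact hwx rfl
  apply notMem_thinMembers_of_rkN_sdiff_le_four hd _ hthin
  have hsub : G \ T.erase w ⊆ clF M B₀ \ coloops M G := by
    intro e he
    rw [Finset.mem_sdiff, Finset.mem_erase] at he
    rw [Finset.mem_sdiff]
    by_cases hew : e = w
    · subst hew
      exact ⟨hwcl, hw.2⟩
    · have heT : e ∉ T := fun h => he.2 ⟨hew, h⟩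
      refine ⟨?_, fun hK => heT (hQT (hKQ hK))⟩
      by_contra hecl
      rcases hoff e he.1 hecl with rfl | rfl
      · exact heT (hQT hw₀)
      · exact heT hxT
  calc rkN M (G \ T.erase w) ≤ rkN M (clF M B₀ \ coloops M G) := rkN_mono hsub
    _ = 4 := rkN_clF_sdiff_coloops_eq_four_two hG hd hk hB₀

/-- **`L1 = 0` at every target containing the off-point** of the fat split. -/
theorem L1_eq_zero_of_fat_off_mem (hG : G ∈ flatsQ M (5 + 1)) (hd : (gr M \ G).card = 2)
    (hk : kColoops M G = 1) {B₀ : Finset α} (hB₀ : B₀ ∈ thinMembers M 5 G) {w₀ x : α}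
    (hD : G \ clF M B₀ = {w₀, x}) {B : Finset α} (hB : B ∈ thinMembers M 5 G) {z : α}
    (hz : z ∈ G \ clF M B) (hw₀ : w₀ ∈ insert z B) (hx : x ∉ insert z B) {T : Finset α}
    (hT : T ∈ tgtSets M 5 G B z) (hxT : x ∈ T) : L1 M 5 G T = 0 := by
  rw [L1_eq_sum_req_faces hG hd]
  apply Finset.sum_eq_zero
  intro w hw
  rw [Finset.mem_filter] at hw
  exact (not_faceOk_of_fat_off_mem hG hd hk hB₀ hD hB hz hw₀ hx hT hxT hw.1 hw.2).elim

/-- **The typed floor is at least `11/18` at every unloaded target containing the off-point.** -/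
theorem eleven_eighteenths_le_vType_of_fat_off_mem (hG : G ∈ flatsQ M (5 + 1)) (hd : (gr M \ G).card = 2)
    (hk : kColoops M G = 1) {B₀ : Finset α} (hB₀ : B₀ ∈ thinMembers M 5 G) {w₀ x : α}
    (hD : G \ clF M B₀ = {w₀, x}) {B : Finset α} (hB : B ∈ thinMembers M 5 G) {z : α}
    (hz : z ∈ G \ clF M B) (hw₀ : w₀ ∈ insert z B) (hx : x ∉ insert z B) {T : Finset α}
    (hT : T ∈ tgtSets M 5 G B z) (hxT : x ∈ T)
    (h0 : dload M 5 G (bigP M G) (dshGT2 M 5 G) T = 0) : (11 / 18 : ℚ) ≤ vType M G T := by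
  have hL := L1_eq_zero_of_fat_off_mem hG hd hk hB₀ hD hB hz hw₀ hx hT hxT
  unfold vType
  split_ifs with h1
  · norm_num
  · rw [hL, sub_zero]
    exact le_max_right _ _

/-- The face sum is nonnegative. -/
theorem faceSum_nonneg (T : Finset α) : 0 ≤ faceSum M G T := by
  unfold faceSum
  apply Finset.sum_nonneg
  intro B _
  exact mul_nonneg (phiFace_nonneg _) (Nat.cast_nonneg _)

/-- **The basis pairs' fair share from the face criterion on a SUB-FAMILY of the targets**:
`1 ≤ Σ_{T ∈ 𝒯} vType T / faceSum T` for some `𝒯 ⊆ tgtSets B z` suffices. -/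
theorem basis_pair_fair_of_face_sum_subfamily (hG : G ∈ flatsQ M (5 + 1)) (hd : (gr M \ G).card = 2)
    (hk : kColoops M G = 1) (hs : ∀ e ∈ gr M, ∀ f ∈ gr M, e ≠ f → rkN M {e, f} = 2)
    (hl : ∀ e ∈ gr M, M.Indep {e}) (hfat : (fatClosures M 5 G 2).card ≤ 1)
    {B : Finset α} (hB : B ∈ thinMembers M 5 G) (hnP : ¬ bigP M G B) {z : α} (hz : z ∈ G \ clF M B)
    (hl0 : loss M 5 G B z ≠ 0) {𝒯 : Finset (Finset α)} (h𝒯 : 𝒯 ⊆ tgtSets M 5 G B z)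
    (hsum : 1 ≤ ∑ T ∈ 𝒯, vType M G T / faceSum M G T) :
    loss M 5 G B z ≤ rhoL M 5 G B z * lossIncomeH M 5 G (bigP M G) (dshGT2 M 5 G) B z := by
  have hd' : (gr M \ G).card ≤ 5 := by omega
  have hB4 := card_sdiff_eq_four_of_not_bigP hG hd hk hB hnP
  set D : ℚ := ((2 ^ (G.card - 6) - 1 : ℕ) : ℚ) with hD
  have hDpos : 0 < D := by
    rw [hD]
    have h7 : 7 ≤ G.card := by
      have hKB : coloops M G ⊆ B := coloops_subset_of_mem_thinMembers hG hd' hB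
      have hBG : B ⊆ G := subset_G_of_mem_thinMembers hB
      have h1 := Finset.card_sdiff_add_card_eq_card hKB
      rw [← kColoops_eq_card_coloops, hk] at h1
      have h2 := two_le_card_sdiff_of_not_lay0 hG hd' (mem_thinMembers.1 hB).1 (mem_thinMembers.1 hB).2
      have hdisj : Disjoint B (G \ clF M B) := by
        rw [Finset.disjoint_left]
        intro a ha ha'
        exact (Finset.mem_sdiff.1 ha').2 (subset_clF_of_subset_gr (hBG.trans (mem_flatsQ.1 hG).1) ha)
      have h3 := Finset.card_le_card (Finset.union_subset hBG (Finset.sdiff_subset : G \ clF M B ⊆ G))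
      rw [Finset.card_union_of_disjoint hdisj] at h3
      omega
    have : 2 ≤ 2 ^ (G.card - 6) := by
      calc 2 = 2 ^ 1 := by norm_num
        _ ≤ 2 ^ (G.card - 6) := Nat.pow_le_pow_right (by norm_num) (by omega)
    exact_mod_cast (by omega : 0 < 2 ^ (G.card - 6) - 1)
  have hrho : rhoL M 5 G B z = loss M 5 G B z / D := by
    unfold rhoL
    rw [card_tgtSets hG (mem_thinMembers.1 hB).1 hz,
      card_sdiff_insert_eq_dqm1 (ρ := 5) hG hd' hB (by omega) hz, hk]
    have hcard : G.card - 1 - 5 = G.card - 6 := by omega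
    rw [hcard]
  set u : Finset α → ℚ := fun T => faceSum M G T / D with hu
  have hmass : ∀ T ∈ 𝒯, pi2MassH M 5 G (bigP M G) T ≤ u T := fun T hT =>
    pi2MassH_le_face_sum hG hd hk (subset_G_of_mem_shadowAt (mem_tgtSets.1 (h𝒯 hT)).1)
      (coloops_subset_of_mem_shadowAt (mem_tgtSets.1 (h𝒯 hT)).1)
  have hinc := lossIncomeH_ge_of_subfamily hG hd' (column_side_gt2 hG hd hk hs hl hfat) hB hnP hz hl0
    h𝒯 u (vType M G) hmass
    (fun _ hT => vType_le_cap3 hG hd hk hs hl hfat (subset_G_of_mem_shadowAt (mem_tgtSets.1 (h𝒯 hT)).1)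
      (coloops_subset_of_mem_shadowAt (mem_tgtSets.1 (h𝒯 hT)).1)) (fun _ _ => vType_nonneg _)
  have hsplit : ∑ T ∈ 𝒯, vType M G T / u T = D * ∑ T ∈ 𝒯, vType M G T / faceSum M G T := by
    rw [Finset.mul_sum]
    apply Finset.sum_congr rfl
    intro T _
    simp only [hu]
    by_cases hc : faceSum M G T = 0
    · rw [hc]
      simp
    · field_simp
  have hD' : D ≤ ∑ T ∈ 𝒯, vType M G T / u T := by
    rw [hsplit]
    have := mul_le_mul_of_nonneg_left hsum hDpos.le
    linarith
  rw [hrho]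
  have hloss0 : 0 ≤ loss M 5 G B z := loss_nonneg (le_trans (by norm_num)
    (capS_ge_eleven_eighteenths_two_one hd hk (Finset.insert_subset (Finset.mem_sdiff.1 hz).1
      (subset_G_of_mem_thinMembers hB))))
  calc loss M 5 G B z = loss M 5 G B z / D * D := by field_simp
    _ ≤ loss M 5 G B z / D * lossIncomeH M 5 G (bigP M G) (dshGT2 M 5 G) B z := by
        apply mul_le_mul_of_nonneg_left (hD'.trans hinc)
        exact div_nonneg hloss0 hDpos.le

/-- **The fat case of (FAIR) from the unloaded targets containing the off-point**: with the fat split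
`G ∖ clF B₀ = {w₀, x}`, `1 ≤ Σ_{T ∈ tgtSets B z, x ∈ T, dload T = 0} (11/18) / faceSum T` gives the basis pair's
fair share. -/
theorem basis_pair_fair_of_fat_off_sum (hG : G ∈ flatsQ M (5 + 1)) (hd : (gr M \ G).card = 2)
    (hk : kColoops M G = 1) (hs : ∀ e ∈ gr M, ∀ f ∈ gr M, e ≠ f → rkN M {e, f} = 2)
    (hl : ∀ e ∈ gr M, M.Indep {e}) (hfat : (fatClosures M 5 G 2).card ≤ 1)
    {B₀ : Finset α} (hB₀ : B₀ ∈ thinMembers M 5 G) {w₀ x : α} (hD : G \ clF M B₀ = {w₀, x})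
    {B : Finset α} (hB : B ∈ thinMembers M 5 G) (hnP : ¬ bigP M G B) {z : α} (hz : z ∈ G \ clF M B)
    (hl0 : loss M 5 G B z ≠ 0) (hw₀ : w₀ ∈ insert z B) (hx : x ∉ insert z B)
    (hsum : 1 ≤ ∑ T ∈ (tgtSets M 5 G B z).filter
      (fun T => x ∈ T ∧ dload M 5 G (bigP M G) (dshGT2 M 5 G) T = 0), (11 / 18 : ℚ) / faceSum M G T) :
    loss M 5 G B z ≤ rhoL M 5 G B z * lossIncomeH M 5 G (bigP M G) (dshGT2 M 5 G) B z := by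
  apply basis_pair_fair_of_face_sum_subfamily (𝒯 := (tgtSets M 5 G B z).filter
    (fun T => x ∈ T ∧ dload M 5 G (bigP M G) (dshGT2 M 5 G) T = 0)) hG hd hk hs hl hfat hB hnP hz hl0
    (Finset.filter_subset _ _)
  refine le_trans hsum (Finset.sum_le_sum ?_)
  intro T hT
  rw [Finset.mem_filter] at hT
  apply div_le_div_of_nonneg_right _ (faceSum_nonneg T)
  exact eleven_eighteenths_le_vType_of_fat_off_mem hG hd hk hB₀ hD hB hz hw₀ hx hT.1 hT.2.1 hT.2.2

end PercRepro.Shadow
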